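import Mathlib
import Literature.AlgebraicGeometry.Resolution.MarkedIdeals
import Summits.ResolutionOfSingularities.ResolutionOfSingularities.Theorems.WeightedInvariantELadderOneBase
import Summits.ResolutionOfSingularities.ResolutionOfSingularities.Theorems.WeightedInvariantELadderOneOrbitOfDim
import Summits.ResolutionOfSingularities.ResolutionOfSingularities.Theorems.WeightedInvariantELadderOneTrivialEndRing
import Summits.ResolutionOfSingularities.ResolutionOfSingularities.Theorems.WeightedInvariantStrictTransformDimension
import Summits.ResolutionOfSingularities.ResolutionOfSingularities.Theorems.WeightedInvariantRegularSubschemeCentre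
import Summits.ResolutionOfSingularities.ResolutionOfSingularities.Theorems.WeightedInvariantDatumToEmbeddedAtlasAmbientChart
import Summits.ResolutionOfSingularities.ResolutionOfSingularities.Theorems.WeightedInvariantDatumToEmbeddedExceptional
import Summits.ResolutionOfSingularities.ResolutionOfSingularities.Theorems.WeightedInvariantWeightedThesisGlobalCobordantPlus
import Summits.ResolutionOfSingularities.ResolutionOfSingularities.Theorems.WeightedInvariantHypersurfaceCentreChoiceToDatum
import HarnessLib

/-!
# Rung `e = 1`: off the centre, singular points of the strict transform lie over singular points (M5)

Route `ResolutionOfSingularities/WeightedInvariant`, door crux `HypersurfaceCentreConstruction`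
(stmt-ResolutionOfSingularities-19897), e-ladder `e = 1` of `res-L1-w43-stub-10` (cell res-hironaka); the LAST input
of the registered stub `stub_e1_inv_succ` (assembly `ELadderOne.stub_e1_inv_succ_of_singOverSupport`).  Scheme level
of res-D-pv-023 AS type-o7's ring-level trivial end (`Theorems/WeightedInvariantELadderOneTrivialEndRing.lean`,
`isRegularLocalRing_localization_quotient_saturation`: Włodarczyk, arXiv:2203.03090, Def. 2.3.5 — `B₋ = B ∖ V(t⁻¹)`
is the trivial end `Y × 𝔾ₘ` of the cobordism):

* `ELadderOne.piPlus_mem_singImage_of_not_mem_support` — for a closed immersion `i : X ⟶ Y` into `Y` locally of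
  finite type over a field, a regular weighted centre `R`, its Rees filtration `R'` and a point `η'` of the image
  of the non-regular locus of the strict transform `V(σˢ(ker i)) ⊆ B₊` with `σ₊ η'` OFF the support of `R`:
  `σ₊ η'` lies in the image of the non-regular locus of `V(ker i)`.

Proof: an affine `W ∋ σ₊ η'` off one positive piece has all pieces `= ⊤` (`ideal_eq_top_of_pos`), so the
sections ring `⊕ 𝒥ₙ(W) tⁿ` is the whole Laurent ring, `t`, `t⁻¹` are units and the chart `D(tⁿ) = σ₊⁻¹W` of `B₊`
(`AtlasAmbient.exists_chart`, `Exceptional.exists_mem_plusChart`) contains `η'`; by the ring-level trivial end the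
local ring of `B₊` at `η'` modulo the (trivially saturated) strict transform is regular as soon as
`𝒪_{Y,σ₊η'} ⧸ (ker i)` is — i.e. as soon as `σ₊ η'` is not in the singular image; the quotients are the local rings
of `V(σˢ(ker i))` and `V(ker i)` (`ELadderOne.nonempty_quotient_stalkIdeal_equiv`).

Nothing here is a claim about Hironaka's problem; AI-written, weaker than expert review.
-/

noncomputable section

set_option linter.dupNamespace false -- mandated namespace of this single-conjunct summit
-- `Γ(B₊, W')` versus `presheaf.obj` inside `rw` motives and instance problems on the glued scheme
-- `R'.cobordantBlowup` / `R'.plus` (as in `…DatumToEmbedded.AtlasAmbientChart`):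
set_option backward.isDefEq.respectTransparency false

open scoped LaurentPolynomial
open LaurentPolynomial CategoryTheory AlgebraicGeometry TopologicalSpace IsLocalRing
open Literature.AlgebraicGeometry.Resolution
open Summit.ResolutionOfSingularities.ResolutionOfSingularities.Theorems
open Summit.ResolutionOfSingularities.ResolutionOfSingularities.Theorems.DatumToEmbedded.AtlasAmbient

namespace Summit.ResolutionOfSingularities.ResolutionOfSingularities.Theorems.ELadderOne

variable {k : Type} [Field k] {Y X : Scheme.{0}}

/-- The ideal of an ideal sheaf on an affine chart lies in the prime of every point of its support there.
[folklore] -/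
theorem ideal_le_primeIdealOf_of_mem_support {Z : Scheme.{0}} (I : Z.IdealSheafData) (U : Z.affineOpens)
    {z : Z} (hzU : z ∈ (U : Z.Opens)) (hz : z ∈ I.support) :
    I.ideal U ≤ (U.2.primeIdealOf ⟨z, hzU⟩).asIdeal := by
  intro g hg
  rw [Scheme.IdealSheafData.mem_support_iff_of_mem (U := U) hzU, Scheme.mem_zeroLocus_iff] at hz
  have h := hz g hg
  rw [Stage.mem_basicOpen_iff_not_mem_primeIdealOf U hzU g, not_not] at h
  exact h

/-- **(M5) Off the centre, singular points of the strict transform lie over singular points.**  Let `Y` be locally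
of finite type over a field `k`, `i : X ⟶ Y` a closed immersion, `R` a regular weighted centre with Rees filtration
`R'` and cobordant blow-up `σ₊ : B₊ → Y`, and `η' ∈ B₊` a point of the image of the non-regular locus of
`V(σˢ(ker i))` with `σ₊ η' ∉ supp R`.  Then `σ₊ η'` is in the image of the non-regular locus of `V(ker i)`: over an
affine `W ∋ σ₊ η'` off the centre, `σ₊⁻¹ W = W × 𝔾ₘ` and `V(σˢ(ker i)) ∩ σ₊⁻¹W = V(ker i) × 𝔾ₘ`, which is regular over
the regular points of `V(ker i)`. [cite: Wlodarczyk2022, Def. 2.3.5 and 3.3.12] -/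
theorem piPlus_mem_singImage_of_not_mem_support (f : Y ⟶ Spec (.of k)) [LocallyOfFiniteType f]
    (i : X ⟶ Y) [IsClosedImmersion i] (R : ReesAlgebraData Y) (hc : R.IsRegularWeightedCentre)
    (R' : ReesFiltration Y) (hR' : R'.ideal = R.piece) (η' : ↥R'.plus)
    (hη' : η' ∈ singImage (R'.strictTransformPlus i.ker)) (hys : R'.πPlus η' ∉ R.support) :
    R'.πPlus η' ∈ singImage i.ker := by
  classical
  haveI : IsLocallyNoetherian Y := LocallyOfFiniteType.isLocallyNoetherian f
  haveI : LocallyOfFiniteType R'.π := WeightedThesis.GlobalCobordantPlus.locallyOfFiniteType_π R R' hR' hc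
  haveI : IsLocallyNoetherian R'.cobordantBlowup := LocallyOfFiniteType.isLocallyNoetherian R'.π
  by_contra hy
  obtain ⟨x', hx'η, hx'reg⟩ := hη'
  apply hx'reg
  -- (1) an affine `W ∋ σ₊ η'` on which all pieces are the unit ideal
  obtain ⟨n, hn, hyn⟩ : ∃ n : ℕ, 0 < n ∧ R'.πPlus η' ∉ (R.piece n).support := by
    by_contra h
    push Not at h
    exact hys (R.mem_support_iff.mpr h)
  obtain ⟨_, ⟨W₁, hWaff, rfl⟩, hyW, hWle⟩ := Y.isBasis_affineOpens.exists_subset_of_mem_open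
    (show R'.πPlus η' ∈ ((R.piece n).support : Set Y)ᶜ from hyn) (R.piece n).support.isClosed.isOpen_compl
  obtain ⟨W, hWW₁⟩ : ∃ W : Y.affineOpens, (W : Y.Opens) = W₁ := ⟨⟨W₁, hWaff⟩, rfl⟩
  have hyW' : R'.πPlus η' ∈ (W : Y.Opens) := hWW₁ ▸ hyW
  have hWle' : ((W : Y.Opens) : Set Y) ⊆ ((R.piece n).support : Set Y)ᶜ := hWW₁ ▸ hWle
  have hWn : (R'.ideal n).ideal W = ⊤ := by
    rw [hR']
    exact ideal_eq_top_of_forall_not_mem_support (R.piece n) W fun y hy hmem => hWle' hy hmem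
  have hall : ∀ m, (R'.ideal m).ideal W = ⊤ := StrictTransformDimension.ideal_eq_top_of_pos R' W hn hWn
  -- (2) the sections ring over `W` is the whole Laurent ring; `t`, `t⁻¹`, `tⁿ` are units
  haveI : IsNoetherianRing Γ(Y, W) := IsLocallyNoetherian.component_noetherian W
  have hS : ∀ p : (Γ(Y, W))[T;T⁻¹], p ∈ R'.sectionsRing W := fun p => by
    rw [IdealFiltration.mem_extendedRees_iff]
    intro m
    rw [ReesFiltration.filtration_ideal, hall m]
    trivial
  let t : R'.sectionsRing W := ⟨T (-1), (R'.filtration W).T_neg_one_mem_extendedRees⟩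
  have ht : ((t : (R'.sectionsRing W)) : (Γ(Y, W))[T;T⁻¹]) = T (-1) := rfl
  have htu : IsUnit t := by
    refine isUnit_iff_exists_inv.mpr ⟨⟨T 1, hS _⟩, Subtype.ext ?_⟩
    show (T (-1) * T 1 : (Γ(Y, W))[T;T⁻¹]) = 1
    rw [← T_add, neg_add_cancel, T_zero]
  let v₀ : R'.sectionsRing W := ⟨T (n : ℤ), hS _⟩
  have hv₀irr : v₀ ∈ (R'.filtration W).irrelevant := by
    refine Ideal.subset_span ⟨n, 1, hn, ?_, ?_⟩
    · rw [ReesFiltration.filtration_ideal, hWn]; trivial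
    · show (T (n : ℤ) : (Γ(Y, W))[T;T⁻¹]) = C 1 * T (n : ℤ)
      rw [map_one, one_mul]
  have hv₀u : IsUnit v₀ := by
    refine isUnit_iff_exists_inv.mpr ⟨⟨T (-(n : ℤ)), hS _⟩, Subtype.ext ?_⟩
    show (T (n : ℤ) * T (-(n : ℤ)) : (Γ(Y, W))[T;T⁻¹]) = 1
    rw [← T_add, add_neg_cancel, T_zero]
  haveI : IsLocalization.Away v₀ (R'.sectionsRing W) :=
    IsLocalization.away_of_isUnit_of_bijective _ hv₀u Function.bijective_id
  -- (3) the chart `D(v₀) ∋ η'` of `B₊`, with coordinate ring `⊕ 𝒥ₙ(W) tⁿ` itself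
  obtain ⟨W', hW', e, he₁, he₂, he₃, he₄⟩ := exists_chart R' W (R'.sectionsRing W) v₀ hv₀irr
  obtain ⟨q₀, -, hq₀⟩ := DatumToEmbedded.Exceptional.exists_mem_plusChart R' η'.1 η'.2 W hyW'
  have hη'W' : η' ∈ (W' : (R'.plus : Scheme.{0}).Opens) :=
    he₄ η' q₀ hq₀ fun h => q₀.2.ne_top (Ideal.eq_top_of_isUnit_mem _ h hv₀u)
  have halg : algebraMap (R'.sectionsRing W) (R'.sectionsRing W) = RingHom.id _ := Algebra.algebraMap_self
  -- the strict transform on the chart is the extension of `I(W)` (the saturation by the unit `t` is trivial)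
  let J : Ideal (R'.sectionsRing W) := ⨆ m : ℕ, ((i.ker.ideal W).map (algebraMap Γ(Y, W) (R'.sectionsRing W))).colon
      ((Ideal.span {t} ^ m : Ideal (R'.sectionsRing W)) : Set (R'.sectionsRing W))
  have hJeq : J = (i.ker.ideal W).map (algebraMap Γ(Y, W) (R'.sectionsRing W)) := by
    have htop : ∀ m : ℕ, ((Ideal.span {t} ^ m : Ideal (R'.sectionsRing W)) : Set (R'.sectionsRing W)) = Set.univ :=
      fun m => by rw [Ideal.span_singleton_eq_top.mpr htu, Ideal.top_pow]; rfl
    refine le_antisymm (iSup_le fun m => ?_) (le_iSup_of_le 0 ?_)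
    · rw [htop m, Submodule.colon_univ]
    · rw [htop 0, Submodule.colon_univ]
  have hI'W' : (R'.strictTransformPlus i.ker).ideal W' = J.comap e.toRingHom := by
    rw [he₃ i.ker, halg, RingHom.id_comp]
    rfl
  -- (4) the primes: `P'` of `η'` on the chart, `Q` its transport to `⊕ 𝒥ₙ tⁿ`, `p` of `σ₊ η'` on `W`
  let P' := W'.2.primeIdealOf ⟨η', hη'W'⟩
  obtain ⟨Q, hQdef⟩ : ∃ Q : Ideal (R'.sectionsRing W), Q = P'.asIdeal.map e.toRingHom := ⟨_, rfl⟩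
  haveI hQ : Q.IsPrime := by rw [hQdef]; exact Ideal.map_isPrime_of_equiv e
  have hebij : Function.Bijective e.toRingHom := e.bijective
  have hQcomap : Q.comap e.toRingHom = P'.asIdeal := by
    rw [hQdef]
    exact Ideal.comap_map_of_bijective e.toRingHom hebij
  have htQ : t ∉ Q := fun h => hQ.ne_top (Ideal.eq_top_of_isUnit_mem _ h htu)
  let p := W.2.primeIdealOf ⟨R'.πPlus η', hyW'⟩
  have halgW : ∀ s : Γ(Y, W), algebraMap Γ(Y, W) (R'.sectionsRing W) s = e (R'.πPlus.appLE W W' hW' s) := fun s => by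
    rw [he₁ s, halg, RingHom.id_apply]
  have hp : Q.comap (algebraMap Γ(Y, W) (R'.sectionsRing W)) = p.asIdeal := by
    have h1 : algebraMap Γ(Y, W) (R'.sectionsRing W) = e.toRingHom.comp (R'.πPlus.appLE W W' hW').hom :=
      RingHom.ext fun s => halgW s
    rw [h1, ← Ideal.comap_comap, hQcomap]
    exact congr($(IsAffineOpen.comap_primeIdealOf_appLE (f := R'.πPlus) (x := η') W W.2 W' W'.2 hW' hη'W').1)
  -- `η'` lies on `V(σˢ I)`, so `σˢI(W') ≤ P'` and `I(W) · ⊕𝒥ₙtⁿ ≤ Q`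
  have hη'supp : (η' : ↥R'.plus) ∈ (R'.strictTransformPlus i.ker).support := by
    rw [← SetLike.mem_coe, ← Scheme.IdealSheafData.range_subschemeι]
    exact ⟨x', hx'η⟩
  have hI'P' : (R'.strictTransformPlus i.ker).ideal W' ≤ P'.asIdeal :=
    ideal_le_primeIdealOf_of_mem_support (R'.strictTransformPlus i.ker) W' hη'W' hη'supp
  have h𝔞Q : (i.ker.ideal W).map (algebraMap Γ(Y, W) (R'.sectionsRing W)) ≤ Q := by
    rw [← hJeq]
    have h : J = (J.comap e.toRingHom).map e.toRingHom :=
      (Ideal.map_comap_of_surjective e.toRingHom hebij.2 J).symm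
    rw [h, hQdef]
    exact Ideal.map_mono (hI'W' ▸ hI'P')
  -- (5) `σ₊ η'` is a point of `V(I)` with regular local ring (it is not in the singular image)
  have hy_supp : R'.πPlus η' ∈ i.ker.support := by
    rw [Scheme.IdealSheafData.mem_support_iff_of_mem (U := W) hyW', Scheme.mem_zeroLocus_iff]
    intro g hg hyg
    rw [Stage.mem_basicOpen_iff_not_mem_primeIdealOf W hyW' g] at hyg
    apply hyg
    have hgQ : algebraMap Γ(Y, W) (R'.sectionsRing W) g ∈ Q := h𝔞Q (Ideal.mem_map_of_mem _ hg)
    have hgp : g ∈ Q.comap (algebraMap Γ(Y, W) (R'.sectionsRing W)) := hgQ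
    rwa [hp] at hgp
  obtain ⟨x, hx⟩ : R'.πPlus η' ∈ Set.range i.ker.subschemeι := by
    rw [Scheme.IdealSheafData.range_subschemeι]; exact hy_supp
  have hxreg : IsRegularLocalRing (i.ker.subscheme.presheaf.stalk x) := by
    by_contra hx'
    exact hy ⟨x, hx, hx'⟩
  -- `A_p ⧸ I A_p ≅ 𝒪_{Y,σ₊η'} ⧸ I_{σ₊η'} ≅ 𝒪_{V(I),x}` is regular
  have hreg : IsRegularLocalRing (Localization.AtPrime p.asIdeal ⧸
      (i.ker.ideal W).map (algebraMap Γ(Y, W) (Localization.AtPrime p.asIdeal))) := by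
    letI := Y.presheaf.algebra_section_stalk (⟨R'.πPlus η', hyW'⟩ : (W : Y.Opens))
    haveI hloc := W.2.isLocalization_stalk ⟨R'.πPlus η', hyW'⟩
    let φA := IsLocalization.algEquiv p.asIdeal.primeCompl (Localization.AtPrime p.asIdeal)
        (Y.presheaf.stalk (R'.πPlus η'))
    let φ := φA.toRingEquiv
    have hφ : stalkIdeal i.ker (R'.πPlus η') =
        ((i.ker.ideal W).map (algebraMap Γ(Y, W) (Localization.AtPrime p.asIdeal))).map φ.toRingHom := by
      rw [stalkIdeal_eq_map_germ i.ker W hyW', Ideal.map_map]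
      congr 1
      ext s
      change (Y.presheaf.germ W _ hyW').hom s = φA (algebraMap Γ(Y, W) (Localization.AtPrime p.asIdeal) s)
      rw [φA.commutes s]
      rfl
    obtain ⟨e₂⟩ := nonempty_quotient_stalkIdeal_equiv i.ker x
    have e₂' : (Y.presheaf.stalk (R'.πPlus η') ⧸ stalkIdeal i.ker (R'.πPlus η')) ≃+*
        i.ker.subscheme.presheaf.stalk x := by rw [← hx]; exact e₂
    exact IsRegularLocalRing.of_ringEquiv
      ((Ideal.quotientEquiv _ _ φ hφ).trans e₂').symm
  -- (6) the stalk of `B₊` at `η'` is the localization of `⊕ 𝒥ₙ(W) tⁿ` at `Q` (along `e`)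
  letI algO : Algebra Γ((R'.plus : Scheme.{0}), W') ((R'.plus : Scheme.{0}).presheaf.stalk η') :=
    (R'.plus : Scheme.{0}).presheaf.algebra_section_stalk (⟨η', hη'W'⟩ : ((W' : (R'.plus : Scheme.{0}).Opens)))
  haveI hlocO : IsLocalization.AtPrime ((R'.plus : Scheme.{0}).presheaf.stalk η') P'.asIdeal :=
    W'.2.isLocalization_stalk ⟨η', hη'W'⟩
  have hloc₁ := IsLocalization.isLocalization_of_base_ringEquiv P'.asIdeal.primeCompl
    ((R'.plus : Scheme.{0}).presheaf.stalk η') e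
  letI algR : Algebra (R'.sectionsRing W) ((R'.plus : Scheme.{0}).presheaf.stalk η') :=
    ((algebraMap Γ((R'.plus : Scheme.{0}), W') ((R'.plus : Scheme.{0}).presheaf.stalk η')).comp
      e.symm.toRingHom).toAlgebra
  haveI hloc₂ : IsLocalization.AtPrime ((R'.plus : Scheme.{0}).presheaf.stalk η') Q := by
    unfold IsLocalization.AtPrime
    convert hloc₁ using 2
    ext w
    simp only [Submonoid.mem_map, Ideal.mem_primeCompl_iff]
    constructor
    · intro hw
      refine ⟨e.symm w, fun h => hw ?_, by simp⟩
      rw [← hQcomap, Ideal.mem_comap] at h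
      simpa using h
    · rintro ⟨z, hz, rfl⟩
      intro hw
      apply hz
      rw [← hQcomap, Ideal.mem_comap]
      exact hw
  -- (7) the ring-level trivial end, read on the stalk, and the local ring of `V(σˢ I)` at `x'`
  have key := TrivialEnd.isRegularLocalRing_localization_quotient_saturation (R'.filtration W) t ht
    (i.ker.ideal W) Q htQ h𝔞Q hp hreg ((R'.plus : Scheme.{0}).presheaf.stalk η')
  have hideal : stalkIdeal (R'.strictTransformPlus i.ker) η' =
      J.map (algebraMap (R'.sectionsRing W) ((R'.plus : Scheme.{0}).presheaf.stalk η')) := by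
    rw [stalkIdeal_eq_map_germ (R'.strictTransformPlus i.ker) W' hη'W', hI'W']
    have hJe : J.comap e.toRingHom = J.map (e.symm : R'.sectionsRing W →+* _) := by
      rw [RingEquiv.toRingHom_eq_coe]
      exact (Ideal.map_symm e).symm
    rw [hJe, Ideal.map_map]
    rfl
  obtain ⟨e₃⟩ := nonempty_quotient_stalkIdeal_equiv (R'.strictTransformPlus i.ker) x'
  have e₃' : ((R'.plus : Scheme.{0}).presheaf.stalk η' ⧸ stalkIdeal (R'.strictTransformPlus i.ker) η') ≃+*
      (R'.strictTransformPlus i.ker).subscheme.presheaf.stalk x' := by rw [← hx'η]; exact e₃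
  have E := Ideal.quotEquivOfEq hideal.symm
  exact @IsRegularLocalRing.of_ringEquiv _ _ key _ _ (E.trans e₃')

end Summit.ResolutionOfSingularities.ResolutionOfSingularities.Theorems.ELadderOne

end
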